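import Summits.Ventures.LatticeQCDFlow.Scoring.TorusAreaLaw2D
import HarnessLib

/-!
# The exact non-abelian area law in two dimensions, V-h: exponentially small finite-size corrections — the torus expectation of a local observable versus its free-boundary expectation

HONEST FRAMING: exact (Metropolis-corrected) sampling algorithms for lattice gauge theory;
figures of merit are autocorrelation/cost numbers at stated couplings and volumes; no
continuum-physics claim.

Venture `LatticeQCDFlow` (cell pub-lqcd), sub-topic `Scoring`; FANOUT row 5 (`s0-sun-a`), GEN-19.
NEW WORK of the cell (placement rule).  THE ONE-BAD-SET EXPANSION FOR AN ARBITRARY LOCAL OBSERVABLE on the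
torus `(ℤ/L)²` (every compact second-countable gauge group `G`, product Haar reference measure, a continuous
one-plaquette weight `w` pinched as `0 < c₀ ≤ w ≤ s₁`, e.g. theory-2's Wilson weight `e^{−β(N − Re tr ρ)}` at
any real `β`).  For a continuous observable `Φ` which only sees the links of the plaquettes of an `R × T`
rectangle `Reg` (`R + 1 ≤ L`, `T + 1 ≤ L`) and `|Φ| ≤ A`:

* §1 `integral_local_mul_prod_punctured` — real form of part V-a's punctured peeling for a general local
  observable: off a puncture, `∫ Φ ∏_{x∈t} v(U_x) = (∫v)^{#t} ∫ Φ`;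
* §2 `abs_expansion_sub_le` (arithmetic) and **`abs_ratio_local_sub_le`**:
  `|∫ Φ ∏_y w(U_y) / ∫ ∏_y w(U_y) − ∫ Φ ∏_{p∈Reg} w(U_p) / ∫ ∏_{p∈Reg} w(U_p)| ≤ 2A (s₁/c₀) (1 − c₀/m)^{L² − RT − 1}`,
  `m = ∫ w dHaar`: THE TORUS EXPECTATION OF A LOCAL OBSERVABLE DIFFERS FROM ITS FREE-BOUNDARY EXPECTATION BY
  A TERM EXPONENTIALLY SMALL IN THE VOLUME (write `w = c₀ + v` on the `L² − RT` outside plaquettes and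
  expand: every term with a puncture is exact by §1, the single full term costs one factor `s₁`);
* §3 **`abs_wilsonExpectation_local_sub_le`** — the same for theory-2's torus Wilson state `wilsonExpectation ρ β`
  (`Literature…ConstructiveQFTWave0.wilsonMeasure`; `s₁/c₀ = e^{2|β|(N+B)}`, `B = sup |Re tr ρ|`).

Sequel `TorusWilsonLoopLimit2D`: `⟨W_{R×T}⟩_{(ℤ/L)²,β} → P_N(β)^{RT}` (`L → ∞`) for `U(N)`, `SU(N)` — the thermodynamic
limit and the exact string tension `−log P_N(β)` (Gross–Witten, Phys. Rev. D 21 (1980) 446, §II, infinite plane,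
axial gauge; here no characters, no gauge fixing).  No `def`, nothing cited as a fact, 0 sorry.
-/

noncomputable section

open MeasureTheory Function Finset Filter Topology
open Literature.MathematicalPhysics.QuantumFieldTheory
open Literature.MathematicalPhysics.QuantumLattice
open Summit.Ventures.LatticeQCDFlow.Theory2.Lattice
open Summit.Ventures.LatticeQCDFlow.Theory2.Lattice.TwoDim

namespace Summit.Ventures.LatticeQCDFlow.Scoring

variable {L : ℕ} [NeZero L] {G : Type*} [Group G] [TopologicalSpace G] [IsTopologicalGroup G]
  [CompactSpace G] [SecondCountableTopology G] [MeasurableSpace G] [BorelSpace G] {N : ℕ}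
  (ρ : G →* Matrix (Fin N) (Fin N) ℂ)

/-! ## §1. The punctured peeling for a general local observable (real form) -/

omit ρ in
/-- Real form of part V-a's `integral_mul_prod_punctured_eq`: for a continuous real observable `Φ` seeing
only the links of the plaquettes of the rectangle `Reg`, a set `t` of plaquettes outside `Reg` missing a
puncture `x₀ ∉ Reg`, and any continuous `v`: `∫ Φ ∏_{x∈t} v(U_x) dHaar^{⊗E} = (∫ v)^{#t} ∫ Φ dHaar^{⊗E}`. -/
theorem integral_local_mul_prod_punctured (hL : 2 ≤ L) (i' j' : ZMod L) {R T : ℕ} (hR : R + 1 ≤ L)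
    (hT : T + 1 ≤ L) (x₀ : Site 2 L)
    (hx₀ : x₀ ∉ (range R ×ˢ range T).image (fun q : ℕ × ℕ => (![i' + q.1, j' + q.2] : Site 2 L)))
    {v : G → ℝ} (hv : Continuous v) {Φ : GaugeConfig 2 L G → ℝ} (hΦ : Continuous Φ)
    (hΦe : ∀ (e : Edge 2 L) (U : GaugeConfig 2 L G) (g : G),
      (∀ p ∈ (range R ×ˢ range T).image (fun q : ℕ × ℕ => (![i' + q.1, j' + q.2] : Site 2 L)),
        ((p, 0) : Edge 2 L) ≠ e ∧ ((Site.shift p 0, 1) : Edge 2 L) ≠ e ∧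
          ((Site.shift p 1, 0) : Edge 2 L) ≠ e ∧ ((p, 1) : Edge 2 L) ≠ e) → Φ (update U e g) = Φ U)
    (t : Finset (Site 2 L))
    (ht : ∀ x ∈ t, x ∉ (range R ×ˢ range T).image (fun q : ℕ × ℕ => (![i' + q.1, j' + q.2] : Site 2 L)))
    (hx₀t : x₀ ∉ t) :
    ∫ U, Φ U * ∏ x ∈ t, v (plaquetteHolonomy U x 0 1) ∂(Measure.pi fun _ : Edge 2 L => haarProbability G) =
      (∫ g, v g ∂(haarProbability G)) ^ t.card *
        ∫ U, Φ U ∂(Measure.pi fun _ : Edge 2 L => haarProbability G) := by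
  have h : ∫ U, (Φ U : ℂ) * ∏ x ∈ t, (v (plaquetteHolonomy U x 0 1) : ℂ)
        ∂(Measure.pi fun _ : Edge 2 L => haarProbability G) =
      (∫ g, (v g : ℂ) ∂(haarProbability G)) ^ t.card *
        ∫ U, (Φ U : ℂ) ∂(Measure.pi fun _ : Edge 2 L => haarProbability G) :=
    integral_mul_prod_punctured_eq hL i' j' hR hT x₀ hx₀ hv (Complex.continuous_ofReal.comp hΦ)
      (fun e U g he => by
        show ((Φ (update U e g) : ℝ) : ℂ) = (Φ U : ℂ)
        rw [hΦe e U g he]) t ht hx₀t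
  apply Complex.ofReal_injective
  have e1 : (((∫ U, Φ U * ∏ x ∈ t, v (plaquetteHolonomy U x 0 1)
      ∂(Measure.pi fun _ : Edge 2 L => haarProbability G) : ℝ)) : ℂ) =
      ∫ U, (Φ U : ℂ) * ∏ x ∈ t, (v (plaquetteHolonomy U x 0 1) : ℂ)
        ∂(Measure.pi fun _ : Edge 2 L => haarProbability G) := by
    rw [← integral_complex_ofReal]
    congr 1; funext U; push_cast; rfl
  rw [e1, h, integral_complex_ofReal, integral_complex_ofReal]
  push_cast; rfl

/-! ## §2. The one-bad-set expansion for a local observable -/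

omit [NeZero L] [Group G] [TopologicalSpace G] [IsTopologicalGroup G] [CompactSpace G]
  [SecondCountableTopology G] [MeasurableSpace G] [BorelSpace G] ρ in
/-- The arithmetic of the finite-size bound: with `S = m^{n+1} − y^{n+1}`, `y = m − c₀`, `0 < c₀ ≤ m`,
`0 < D`, `|E| ≤ A D`, `|I| ≤ A J`, `0 ≤ J ≤ s₁ yⁿ D`:
`|(S E + I)/(S D + J) − E/D| ≤ 2A (s₁/c₀) (y/m)ⁿ`. -/
theorem abs_expansion_sub_le {I J E D S A s₁ c₀ y m : ℝ} {n : ℕ} (hA : 0 ≤ A) (hs₁ : 0 ≤ s₁)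
    (hc₀ : 0 < c₀) (hc₀m : c₀ ≤ m) (hy : y = m - c₀) (hS : S = m ^ (n + 1) - y ^ (n + 1))
    (hD : 0 < D) (hE : |E| ≤ A * D) (hI : |I| ≤ A * J) (hJ0 : 0 ≤ J) (hJ : J ≤ s₁ * y ^ n * D) :
    |(S * E + I) / (S * D + J) - E / D| ≤ 2 * A * (s₁ / c₀) * (y / m) ^ n := by
  have hm : 0 < m := lt_of_lt_of_le hc₀ hc₀m
  have hy0 : 0 ≤ y := by rw [hy]; linarith
  have hym : y ≤ m := by rw [hy]; linarith
  have hSge : c₀ * m ^ n ≤ S := by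
    have h1 : y ^ n ≤ m ^ n := pow_le_pow_left₀ hy0 hym n
    have h2 : y ^ (n + 1) ≤ y * m ^ n := by rw [pow_succ']; exact mul_le_mul_of_nonneg_left h1 hy0
    rw [hS, pow_succ' m n]
    rw [hy] at h2 ⊢
    nlinarith [h2, pow_nonneg hm.le n]
  have hSpos : 0 < S := lt_of_lt_of_le (by positivity) hSge
  have hSD : 0 < S * D := mul_pos hSpos hD
  have hDen : 0 < S * D + J := by linarith
  have hrew : (S * E + I) / (S * D + J) - E / D = (I * D - E * J) / ((S * D + J) * D) := by
    field_simp; ring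
  rw [hrew, abs_div, abs_of_pos (mul_pos hDen hD), div_le_iff₀ (mul_pos hDen hD)]
  have hnum : |I * D - E * J| ≤ 2 * A * (D * J) := by
    calc |I * D - E * J| ≤ |I * D| + |E * J| := abs_sub _ _
      _ = |I| * D + |E| * J := by rw [abs_mul, abs_mul, abs_of_pos hD, abs_of_nonneg hJ0]
      _ ≤ A * J * D + A * D * J :=
          add_le_add (mul_le_mul_of_nonneg_right hI hD.le) (mul_le_mul_of_nonneg_right hE hJ0)
      _ = 2 * A * (D * J) := by ring
  have hiden : s₁ * y ^ n = s₁ / c₀ * (y / m) ^ n * (c₀ * m ^ n) := by rw [div_pow]; field_simp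
  have hkey : D * J ≤ s₁ / c₀ * (y / m) ^ n * ((S * D + J) * D) :=
    calc D * J ≤ D * (s₁ * y ^ n * D) := mul_le_mul_of_nonneg_left hJ hD.le
      _ = s₁ / c₀ * (y / m) ^ n * (c₀ * m ^ n) * (D * D) := by rw [← hiden]; ring
      _ ≤ s₁ / c₀ * (y / m) ^ n * S * (D * D) := by gcongr
      _ = s₁ / c₀ * (y / m) ^ n * ((S * D) * D) := by ring
      _ ≤ s₁ / c₀ * (y / m) ^ n * ((S * D + J) * D) := by gcongr; linarith
  calc |I * D - E * J| ≤ 2 * A * (D * J) := hnum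
    _ ≤ 2 * A * (s₁ / c₀ * (y / m) ^ n * ((S * D + J) * D)) := mul_le_mul_of_nonneg_left hkey (by positivity)
    _ = 2 * A * (s₁ / c₀) * (y / m) ^ n * ((S * D + J) * D) := by ring

omit ρ in
/-- **THE ONE-BAD-SET EXPANSION FOR A LOCAL OBSERVABLE.**  For a continuous weight `w` pinched as
`0 < c₀ ≤ w ≤ s₁`, a rectangle `Reg` of `R × T` plaquettes with corner `(i', j')` on `(ℤ/L)²` (`R + 1 ≤ L`,
`T + 1 ≤ L`), and a continuous observable `Φ` seeing only the links of the plaquettes of `Reg` with `|Φ| ≤ A`: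
`|∫ Φ ∏_y w(U_y) / ∫ ∏_y w(U_y) − ∫ Φ ∏_{p∈Reg} w(U_p) / ∫ ∏_{p∈Reg} w(U_p)| ≤ 2A (s₁/c₀) (1 − c₀/∫w)^{L² − RT − 1}`:
the torus expectation of a local observable and its free-boundary expectation differ by a term
exponentially small in the number `L² − RT` of plaquettes outside the region. -/
theorem abs_ratio_local_sub_le {w : G → ℝ} (hw : Continuous w) {c₀ s₁ : ℝ} (hc₀ : 0 < c₀)
    (hwlo : ∀ g, c₀ ≤ w g) (hwhi : ∀ g, w g ≤ s₁) (hL : 2 ≤ L) (i' j' : ZMod L) {R T : ℕ}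
    (hR : R + 1 ≤ L) (hT : T + 1 ≤ L) {Φ : GaugeConfig 2 L G → ℝ} (hΦ : Continuous Φ)
    (hΦe : ∀ (e : Edge 2 L) (U : GaugeConfig 2 L G) (g : G),
      (∀ p ∈ (range R ×ˢ range T).image (fun q : ℕ × ℕ => (![i' + q.1, j' + q.2] : Site 2 L)),
        ((p, 0) : Edge 2 L) ≠ e ∧ ((Site.shift p 0, 1) : Edge 2 L) ≠ e ∧
          ((Site.shift p 1, 0) : Edge 2 L) ≠ e ∧ ((p, 1) : Edge 2 L) ≠ e) → Φ (update U e g) = Φ U)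
    {A : ℝ} (hA : ∀ U, |Φ U| ≤ A) :
    |(∫ U, Φ U * ∏ y : Site 2 L, w (plaquetteHolonomy U y 0 1)
          ∂(Measure.pi fun _ : Edge 2 L => haarProbability G)) /
        (∫ U, ∏ y : Site 2 L, w (plaquetteHolonomy U y 0 1)
          ∂(Measure.pi fun _ : Edge 2 L => haarProbability G)) -
      (∫ U, Φ U * ∏ p ∈ (range R ×ˢ range T).image (fun q : ℕ × ℕ => (![i' + q.1, j' + q.2] : Site 2 L)),
          w (plaquetteHolonomy U p 0 1) ∂(Measure.pi fun _ : Edge 2 L => haarProbability G)) /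
        (∫ U, ∏ p ∈ (range R ×ˢ range T).image (fun q : ℕ × ℕ => (![i' + q.1, j' + q.2] : Site 2 L)),
          w (plaquetteHolonomy U p 0 1) ∂(Measure.pi fun _ : Edge 2 L => haarProbability G))|
      ≤ 2 * A * (s₁ / c₀) * (1 - c₀ / ∫ g, w g ∂(haarProbability G)) ^ (L ^ 2 - R * T - 1) := by
  classical
  -- one-plaquette quantities
  set m : ℝ := ∫ g, w g ∂(haarProbability G) with hm_def
  have hwi : Integrable w (haarProbability G) := integrable_haarProbability_of_continuous hw
  have hm_lo : c₀ ≤ m := by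
    have h : ∫ _g : G, c₀ ∂(haarProbability G) ≤ m := integral_mono (integrable_const c₀) hwi hwlo
    simpa using h
  have hm_pos : 0 < m := lt_of_lt_of_le hc₀ hm_lo
  have hs₁ : 0 ≤ s₁ := (hc₀.le.trans (hwlo 1)).trans (hwhi 1)
  have hA0 : 0 ≤ A := (abs_nonneg _).trans (hA (fun _ => 1))
  let v : G → ℝ := fun g => w g - c₀
  have hv : Continuous v := hw.sub continuous_const
  have hv0 : ∀ g, 0 ≤ v g := fun g => sub_nonneg.mpr (hwlo g)
  have hv_le : ∀ g, v g ≤ s₁ := fun g => by show w g - c₀ ≤ s₁; linarith [hwhi g]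
  set y : ℝ := ∫ g, v g ∂(haarProbability G) with hy_def
  have hy : y = m - c₀ := by
    show ∫ g, (w g - c₀) ∂(haarProbability G) = m - c₀
    rw [integral_sub hwi (integrable_const c₀)]
    simp [hm_def]
  -- geometry
  set Reg : Finset (Site 2 L) :=
    (range R ×ˢ range T).image (fun q : ℕ × ℕ => (![i' + q.1, j' + q.2] : Site 2 L)) with hReg
  set O : Finset (Site 2 L) := Regᶜ with hO
  have hO_out : ∀ z ∈ O, z ∉ Reg := fun z hz => Finset.mem_compl.mp hz
  have hcardReg : Reg.card = R * T := card_rectSites i' j' (by omega) (by omega)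
  have hcardO : O.card = L ^ 2 - R * T := by
    rw [hO, Finset.card_compl, hcardReg, Fintype.card_fun, ZMod.card, Fintype.card_fin]
  have hRT : R * T + 1 ≤ L ^ 2 := by nlinarith
  have hn : 1 ≤ O.card := by rw [hcardO]; omega
  obtain ⟨x₁, hx₁⟩ : O.Nonempty := Finset.card_pos.mp (by omega)
  -- integrals over the product measure
  set π : Measure (GaugeConfig 2 L G) := Measure.pi fun _ : Edge 2 L => haarProbability G with hπ
  have hcw : ∀ s : Finset (Site 2 L), Continuous fun U : GaugeConfig 2 L G =>
      ∏ z ∈ s, w (plaquetteHolonomy U z 0 1) := fun s =>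
    continuous_finsetProd _ fun z _ => hw.comp (continuous_config_plaquetteHolonomy z 0 1)
  have hcv : ∀ s : Finset (Site 2 L), Continuous fun U : GaugeConfig 2 L G =>
      ∏ z ∈ s, v (plaquetteHolonomy U z 0 1) := fun s =>
    continuous_finsetProd _ fun z _ => hv.comp (continuous_config_plaquetteHolonomy z 0 1)
  have hRegw_nonneg : ∀ U : GaugeConfig 2 L G, 0 ≤ ∏ p ∈ Reg, w (plaquetteHolonomy U p 0 1) :=
    fun U => Finset.prod_nonneg fun p _ => hc₀.le.trans (hwlo _)
  have hRegw_local : ∀ (e : Edge 2 L) (U : GaugeConfig 2 L G) (g : G),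
      (∀ p ∈ Reg, ((p, 0) : Edge 2 L) ≠ e ∧ ((Site.shift p 0, 1) : Edge 2 L) ≠ e ∧
        ((Site.shift p 1, 0) : Edge 2 L) ≠ e ∧ ((p, 1) : Edge 2 L) ≠ e) →
      ∏ p ∈ Reg, w (plaquetteHolonomy (update U e g) p 0 1) = ∏ p ∈ Reg, w (plaquetteHolonomy U p 0 1) :=
    fun e U g he => Finset.prod_congr rfl fun p hp => by
      obtain ⟨h1, h2, h3, h4⟩ := he p hp
      rw [plaquetteHolonomy_update_of_ne g h1 h2 h3 h4]
  -- the free-boundary quantities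
  set E : ℝ := ∫ U, Φ U * ∏ p ∈ Reg, w (plaquetteHolonomy U p 0 1) ∂π with hE_def
  set D : ℝ := ∫ U, ∏ p ∈ Reg, w (plaquetteHolonomy U p 0 1) ∂π with hD_def
  have hD_pos : 0 < D := by
    have h1 : ∫ _U : GaugeConfig 2 L G, c₀ ^ Reg.card ∂π ≤ D :=
      integral_mono (integrable_const _) (integrable_gaugeConfig_of_continuous (hcw Reg)) fun U => by
        show c₀ ^ Reg.card ≤ ∏ p ∈ Reg, w (plaquetteHolonomy U p 0 1)
        rw [← Finset.prod_const]
        exact Finset.prod_le_prod (fun p _ => hc₀.le) fun p _ => hwlo _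
    have h2 : ∫ _U : GaugeConfig 2 L G, c₀ ^ Reg.card ∂π = c₀ ^ Reg.card := by
      haveI : IsProbabilityMeasure π := by rw [hπ]; infer_instance
      simp
    linarith [pow_pos hc₀ Reg.card]
  have hE_le : |E| ≤ A * D := by
    rw [hE_def, hD_def, ← integral_const_mul]
    refine (abs_integral_le_integral_abs).trans (integral_mono_of_nonneg (ae_of_all _ fun U => abs_nonneg _)
      ((integrable_gaugeConfig_of_continuous (hcw Reg)).const_mul _) (ae_of_all _ fun U => ?_))
    show |Φ U * ∏ p ∈ Reg, w (plaquetteHolonomy U p 0 1)| ≤ A * ∏ p ∈ Reg, w (plaquetteHolonomy U p 0 1)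
    rw [abs_mul, abs_of_nonneg (hRegw_nonneg U)]
    exact mul_le_mul_of_nonneg_right (hA U) (hRegw_nonneg U)
  -- the integrals indexed by outer subsets
  let I : Finset (Site 2 L) → ℝ := fun t => ∫ U, Φ U *
    ((∏ p ∈ Reg, w (plaquetteHolonomy U p 0 1)) * ∏ z ∈ t, v (plaquetteHolonomy U z 0 1)) ∂π
  let J : Finset (Site 2 L) → ℝ := fun t => ∫ U,
    (∏ p ∈ Reg, w (plaquetteHolonomy U p 0 1)) * ∏ z ∈ t, v (plaquetteHolonomy U z 0 1) ∂π
  -- exact values off a puncture (§1)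
  have hI : ∀ t, t ⊆ O → ∀ x₀ ∈ O, x₀ ∉ t → I t = y ^ t.card * E := by
    intro t hsub x₀ hx₀O hx₀t
    have h : ∫ U, (Φ U * ∏ p ∈ Reg, w (plaquetteHolonomy U p 0 1)) *
          ∏ z ∈ t, v (plaquetteHolonomy U z 0 1) ∂π =
        (∫ g, v g ∂(haarProbability G)) ^ t.card *
          ∫ U, Φ U * ∏ p ∈ Reg, w (plaquetteHolonomy U p 0 1) ∂π :=
      integral_local_mul_prod_punctured hL i' j' hR hT x₀ (hO_out x₀ hx₀O) hv
        (Φ := fun U => Φ U * ∏ p ∈ Reg, w (plaquetteHolonomy U p 0 1))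
        (hΦ.mul (hcw Reg)) (fun e U g he => by
          show Φ (update U e g) * ∏ p ∈ Reg, w (plaquetteHolonomy (update U e g) p 0 1) =
            Φ U * ∏ p ∈ Reg, w (plaquetteHolonomy U p 0 1)
          rw [hΦe e U g he, hRegw_local e U g he]) t (fun z hz => hO_out z (hsub hz)) hx₀t
    show ∫ U, Φ U * ((∏ p ∈ Reg, w (plaquetteHolonomy U p 0 1)) *
        ∏ z ∈ t, v (plaquetteHolonomy U z 0 1)) ∂π = y ^ t.card * E
    simp only [← mul_assoc]
    exact h
  have hJ : ∀ t, t ⊆ O → ∀ x₀ ∈ O, x₀ ∉ t → J t = y ^ t.card * D := by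
    intro t hsub x₀ hx₀O hx₀t
    exact integral_local_mul_prod_punctured hL i' j' hR hT x₀ (hO_out x₀ hx₀O) hv (hcw Reg)
      (fun e U g he => hRegw_local e U g he) t (fun z hz => hO_out z (hsub hz)) hx₀t
  have hI' : ∀ t ∈ O.powerset.erase O, I t = y ^ t.card * E := by
    intro t ht
    obtain ⟨htO, ht⟩ := Finset.mem_erase.mp ht
    have hsub : t ⊆ O := Finset.mem_powerset.mp ht
    obtain ⟨x₀, hx₀O, hx₀t⟩ := Finset.exists_of_ssubset (Finset.ssubset_iff_subset_ne.mpr ⟨hsub, htO⟩)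
    exact hI t hsub x₀ hx₀O hx₀t
  have hJ' : ∀ t ∈ O.powerset.erase O, J t = y ^ t.card * D := by
    intro t ht
    obtain ⟨htO, ht⟩ := Finset.mem_erase.mp ht
    have hsub : t ⊆ O := Finset.mem_powerset.mp ht
    obtain ⟨x₀, hx₀O, hx₀t⟩ := Finset.exists_of_ssubset (Finset.ssubset_iff_subset_ne.mpr ⟨hsub, htO⟩)
    exact hJ t hsub x₀ hx₀O hx₀t
  -- the expansion of the two torus integrals
  have hexpand : ∀ (F : GaugeConfig 2 L G → ℝ), Continuous F →
      ∫ U, F U * ∏ z : Site 2 L, w (plaquetteHolonomy U z 0 1) ∂π =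
        ∑ t ∈ O.powerset, c₀ ^ (O \ t).card *
          ∫ U, F U * ((∏ p ∈ Reg, w (plaquetteHolonomy U p 0 1)) * ∏ z ∈ t, v (plaquetteHolonomy U z 0 1)) ∂π := by
    intro F hF
    have hpt : ∀ U : GaugeConfig 2 L G, F U * ∏ z : Site 2 L, w (plaquetteHolonomy U z 0 1) =
        ∑ t ∈ O.powerset, c₀ ^ (O \ t).card *
          (F U * ((∏ p ∈ Reg, w (plaquetteHolonomy U p 0 1)) * ∏ z ∈ t, v (plaquetteHolonomy U z 0 1))) := by
      intro U
      rw [← Finset.prod_mul_prod_compl Reg]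
      have hO' : ∏ z ∈ Regᶜ, w (plaquetteHolonomy U z 0 1) =
          ∑ t ∈ O.powerset, (∏ z ∈ t, v (plaquetteHolonomy U z 0 1)) * c₀ ^ (O \ t).card := by
        rw [← hO]
        have : ∀ z, w (plaquetteHolonomy U z 0 1) = v (plaquetteHolonomy U z 0 1) + c₀ := fun z => by
          show _ = (w _ - c₀) + c₀; ring
        simp_rw [this, Finset.prod_add, Finset.prod_const]
      rw [hO', Finset.mul_sum, Finset.mul_sum]
      exact Finset.sum_congr rfl fun t _ => by ring
    simp_rw [hpt]
    rw [integral_finsetSum _ fun t _ => ?_]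
    · exact Finset.sum_congr rfl fun t _ => integral_const_mul _ _
    · exact (integrable_gaugeConfig_of_continuous (hF.mul ((hcw Reg).mul (hcv t)))).const_mul _
  -- `S` and its value
  set S : ℝ := ∑ t ∈ O.powerset.erase O, c₀ ^ (O \ t).card * y ^ t.card with hS_def
  have hS : S = m ^ O.card - y ^ O.card := by
    have htot : ∑ t ∈ O.powerset, c₀ ^ (O \ t).card * y ^ t.card = m ^ O.card := by
      rw [show m = y + c₀ by rw [hy]; ring, ← Finset.sum_pow_mul_eq_add_pow]
      refine Finset.sum_congr rfl fun t ht => ?_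
      rw [Finset.card_sdiff_of_subset (Finset.mem_powerset.mp ht), mul_comm]
    rw [← htot, ← Finset.sum_erase_add _ _ (Finset.mem_powerset_self O), Finset.sdiff_self,
      Finset.card_empty, pow_zero, one_mul]
    ring
  -- numerator and denominator
  have hNum : ∫ U, Φ U * ∏ z : Site 2 L, w (plaquetteHolonomy U z 0 1) ∂π = S * E + I O := by
    rw [hexpand _ hΦ, ← Finset.sum_erase_add _ _ (Finset.mem_powerset_self O), Finset.sdiff_self,
      Finset.card_empty, pow_zero, one_mul, hS_def, Finset.sum_mul]
    congr 1
    refine Finset.sum_congr rfl fun t ht => ?_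
    show c₀ ^ (O \ t).card * I t = _
    rw [hI' t ht]
    ring
  have hDen : ∫ U, ∏ z : Site 2 L, w (plaquetteHolonomy U z 0 1) ∂π = S * D + J O := by
    have h := hexpand (fun _ => 1) continuous_const
    simp only [one_mul] at h
    rw [h, ← Finset.sum_erase_add _ _ (Finset.mem_powerset_self O), Finset.sdiff_self, Finset.card_empty,
      pow_zero, one_mul, hS_def, Finset.sum_mul]
    congr 1
    refine Finset.sum_congr rfl fun t ht => ?_
    show c₀ ^ (O \ t).card * J t = _
    rw [hJ' t ht]
    ring
  -- the bad terms
  have hRv_nonneg : ∀ (U : GaugeConfig 2 L G) (s : Finset (Site 2 L)),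
      0 ≤ (∏ p ∈ Reg, w (plaquetteHolonomy U p 0 1)) * ∏ z ∈ s, v (plaquetteHolonomy U z 0 1) :=
    fun U s => mul_nonneg (hRegw_nonneg U) (Finset.prod_nonneg fun z _ => hv0 _)
  have hJO_nonneg : 0 ≤ J O := integral_nonneg fun U => hRv_nonneg U O
  have hJO_le : J O ≤ s₁ * y ^ (O.card - 1) * D := by
    have h1 : J O ≤ s₁ * J (O.erase x₁) := by
      show ∫ U, _ ∂π ≤ s₁ * ∫ U, _ ∂π
      rw [← integral_const_mul]
      refine integral_mono_of_nonneg (ae_of_all _ fun U => hRv_nonneg U O)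
        ((integrable_gaugeConfig_of_continuous ((hcw Reg).mul (hcv _))).const_mul _)
        (ae_of_all _ fun U => ?_)
      show (∏ p ∈ Reg, w (plaquetteHolonomy U p 0 1)) * ∏ z ∈ O, v (plaquetteHolonomy U z 0 1) ≤
        s₁ * ((∏ p ∈ Reg, w (plaquetteHolonomy U p 0 1)) * ∏ z ∈ O.erase x₁, v (plaquetteHolonomy U z 0 1))
      rw [← Finset.mul_prod_erase O _ hx₁]
      have hP : 0 ≤ ∏ p ∈ Reg, w (plaquetteHolonomy U p 0 1) := hRegw_nonneg U
      have hQ : 0 ≤ ∏ z ∈ O.erase x₁, v (plaquetteHolonomy U z 0 1) := Finset.prod_nonneg fun z _ => hv0 _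
      nlinarith [hv_le (plaquetteHolonomy U x₁ 0 1), mul_nonneg hP hQ, hv0 (plaquetteHolonomy U x₁ 0 1)]
    rw [hJ (O.erase x₁) (Finset.erase_subset x₁ O) x₁ hx₁ (Finset.notMem_erase x₁ O),
      Finset.card_erase_of_mem hx₁] at h1
    linarith [h1]
  have hIO_le : |I O| ≤ A * J O := by
    show |∫ U, _ ∂π| ≤ A * ∫ U, _ ∂π
    rw [← integral_const_mul]
    refine (abs_integral_le_integral_abs).trans (integral_mono_of_nonneg (ae_of_all _ fun U => abs_nonneg _)
      ((integrable_gaugeConfig_of_continuous ((hcw Reg).mul (hcv _))).const_mul _)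
      (ae_of_all _ fun U => ?_))
    show |Φ U * _| ≤ A * _
    rw [abs_mul, abs_of_nonneg (hRv_nonneg U O)]
    exact mul_le_mul_of_nonneg_right (hA U) (hRv_nonneg U O)
  -- conclude with the arithmetic lemma
  obtain ⟨n, hn'⟩ : ∃ n, O.card = n + 1 := ⟨O.card - 1, by omega⟩
  have hq : y / m = 1 - c₀ / m := by rw [hy]; field_simp
  rw [hNum, hDen, show L ^ 2 - R * T - 1 = n by omega, ← hq]
  rw [hn'] at hS hJO_le
  simp only [Nat.add_sub_cancel] at hJO_le
  exact abs_expansion_sub_le hA0 hs₁ hc₀ hm_lo hy hS hD_pos hE_le hIO_le hJO_nonneg hJO_le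

/-! ## §3. Theory-2's torus Wilson state: local observables -/

/-- **EXPONENTIALLY SMALL FINITE-SIZE CORRECTIONS FOR LOCAL OBSERVABLES** (two-dimensional lattice Yang–Mills
on the torus `(ℤ/L)²`, every compact gauge group, continuous representation `ρ` with `|Re tr ρ| ≤ B`, any real
`β`; theory-2's `wilsonMeasure`).  For a continuous observable `Φ` seeing only the links of the plaquettes of
an `R × T` rectangle `Reg` (`R + 1 ≤ L`, `T + 1 ≤ L`) with `|Φ| ≤ A`:
`|⟨Φ⟩_{L,β} − ⟨Φ⟩_{Reg,β}^{open}| ≤ 2A e^{2|β|(N+B)} (1 − e^{−|β|(N+B)}/m)^{L² − RT − 1}`,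
`⟨Φ⟩^{open}_{Reg,β} = ∫ Φ ∏_{p∈Reg} w / ∫ ∏_{p∈Reg} w`, `w = e^{−β(N − Re tr ρ)}`, `m = ∫ w dHaar`. -/
theorem abs_wilsonExpectation_local_sub_le (hρ : Continuous ρ) (β : ℝ) {B : ℝ}
    (hB : ∀ g : G, |(ρ g).trace.re| ≤ B) (hL : 2 ≤ L) (i' j' : ZMod L) {R T : ℕ}
    (hR : R + 1 ≤ L) (hT : T + 1 ≤ L) {Φ : GaugeConfig 2 L G → ℝ} (hΦ : Continuous Φ)
    (hΦe : ∀ (e : Edge 2 L) (U : GaugeConfig 2 L G) (g : G),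
      (∀ p ∈ (range R ×ˢ range T).image (fun q : ℕ × ℕ => (![i' + q.1, j' + q.2] : Site 2 L)),
        ((p, 0) : Edge 2 L) ≠ e ∧ ((Site.shift p 0, 1) : Edge 2 L) ≠ e ∧
          ((Site.shift p 1, 0) : Edge 2 L) ≠ e ∧ ((p, 1) : Edge 2 L) ≠ e) → Φ (update U e g) = Φ U)
    {A : ℝ} (hA : ∀ U, |Φ U| ≤ A) :
    |wilsonExpectation ρ β Φ -
      (∫ U, Φ U * ∏ p ∈ (range R ×ˢ range T).image (fun q : ℕ × ℕ => (![i' + q.1, j' + q.2] : Site 2 L)),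
          Real.exp (-(β * ((N : ℝ) - (ρ (plaquetteHolonomy U p 0 1)).trace.re)))
          ∂(Measure.pi fun _ : Edge 2 L => haarProbability G)) /
        (∫ U, ∏ p ∈ (range R ×ˢ range T).image (fun q : ℕ × ℕ => (![i' + q.1, j' + q.2] : Site 2 L)),
          Real.exp (-(β * ((N : ℝ) - (ρ (plaquetteHolonomy U p 0 1)).trace.re)))
          ∂(Measure.pi fun _ : Edge 2 L => haarProbability G))| ≤
      2 * A * Real.exp (2 * (|β| * (N + B))) *
        (1 - Real.exp (-(|β| * (N + B))) /
          ∫ g, Real.exp (-(β * ((N : ℝ) - (ρ g).trace.re))) ∂(haarProbability G)) ^ (L ^ 2 - R * T - 1) := by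
  have hw : Continuous fun g : G => Real.exp (-(β * ((N : ℝ) - (ρ g).trace.re))) := by
    have := Complex.continuous_re.comp hρ.matrix_trace
    fun_prop
  have hbound : ∀ g : G, |β * ((N : ℝ) - (ρ g).trace.re)| ≤ |β| * (N + B) := fun g => by
    rw [abs_mul]
    refine mul_le_mul_of_nonneg_left ?_ (abs_nonneg β)
    have h1 := hB g
    have h2 : |((N : ℝ) - (ρ g).trace.re)| ≤ |(N : ℝ)| + |(ρ g).trace.re| := abs_sub _ _
    rw [Nat.abs_cast] at h2
    linarith
  have hwlo : ∀ g : G, Real.exp (-(|β| * (N + B))) ≤ Real.exp (-(β * ((N : ℝ) - (ρ g).trace.re))) :=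
    fun g => Real.exp_le_exp.mpr (by linarith [(abs_le.mp (hbound g)).2])
  have hwhi : ∀ g : G, Real.exp (-(β * ((N : ℝ) - (ρ g).trace.re))) ≤ Real.exp (|β| * (N + B)) :=
    fun g => Real.exp_le_exp.mpr (by linarith [(abs_le.mp (hbound g)).1])
  rw [wilsonExpectation_two_eq_div ρ hρ β]
  have h := abs_ratio_local_sub_le hw (Real.exp_pos _) hwlo hwhi hL i' j' hR hT hΦ hΦe hA
  have hexp : Real.exp (|β| * (N + B)) / Real.exp (-(|β| * (N + B))) = Real.exp (2 * (|β| * (N + B))) := by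
    rw [← Real.exp_sub]
    congr 1
    ring
  rw [hexp] at h
  exact h

end Summit.Ventures.LatticeQCDFlow.Scoring
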